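import Literature.Barriers.AtomisticToContinuum.OneDimensionalHardCoreToeplitz
import Mathlib.Analysis.SpecialFunctions.Integrals.PosLogEqCircleAverage
import Mathlib.Analysis.SpecificLimits.Basic
import HarnessLib

/-!
# Log-concavity and monotonicity in the particle number of Lenard's determinant and of Girardeau's density matrix

Twentieth audit (2026-08-17) of the barrier entry
`Literature.Barriers.AtomisticToContinuum.OneDimensionalHardCore`; theorems only (no definition,
no named fact).  Lenard's Toeplitz determinants `R(n, t) = D_n(f_{t,0})`,
`f_{t,0}(θ) = |e^{iθ} - 1| |e^{iθ} - e^{it}|` (`lenardDet`, companion `OneDimensionalHardCoreToeplitz`),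
give the one-body density matrix of Girardeau's ground state of `N = n + 1` impenetrable bosons on a
ring of length `L` by Lenard's formula `ρ_{n+1}(x, y) = L⁻¹ R(n, 2π(x-y)/L)`
(`girardeauDensityMatrix_eq_lenardDet`) and the zero-momentum (largest) occupation by
`c₀(n+1) = (2π)⁻¹ ∫₀^{2π} R(n, t) dt` (`zeroMomentumOccupation_succ_eq_integral`).  This file proves
two structural facts about the dependence on the particle number at fixed `L`:

1. **Log-concavity** (the item recorded as outstanding in the entry's `scope_caveats` (x)(3)(α)):
   `R(n+2, t) · R(n, t) ≤ R(n+1, t)²` for every angle `t` (`lenardDet_succ_succ_mul_le_sq`), hence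
   `ρ_{N+2}(x, y) · ρ_N(x, y) ≤ ρ_{N+1}(x, y)²` (`girardeauDensityMatrix_succ_succ_mul_le_sq`).  In the
   orthogonal-polynomial language of [cite: ForresterEtAl2003CMP, §3.2 Prop. 4 (3.51)] the
   density-matrix form is `1 - |r_N|² = ρ_{N+2}ρ_N/ρ_{N+1}² ≤ 1` for the reflection coefficients
   `r_N` of Lenard's weight `|1 + z| |1 + uz|`; the determinant form is stronger by the factor
   `N(N+2)/(N+1)²`.
2. **Monotonicity**: `R(n, t) ≤ R(n+1, t)` for every `t` (`lenardDet_le_succ`, `lenardDet_monotone`,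
   `one_le_lenardDet : 1 ≤ R(n, t)`), hence adding a particle never decreases the density matrix
   anywhere, `ρ_N(x, y) ≤ ρ_{N+1}(x, y)` (`girardeauDensityMatrix_le_succ`, with the uniform floor
   `ρ_N(x, y) ≥ 1/L` for `N ≥ 1`, `inv_le_girardeauDensityMatrix`), and the condensate occupation is
   monotone in `N`, `c₀(N) ≤ c₀(N+1)` (`zeroMomentumOccupation_le_succ`,
   `zeroMomentumOccupation_monotone`) — it grows, but (by the entry) only like `√N`.

Proofs.  (1) is the log-concavity `D_{n+2}(w) D_n(w) ≤ D_{n+1}(w)²` of Toeplitz determinants of a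
positive continuous symbol (`Literature.Analysis.Toeplitz.toeplitzDet_succ_succ_mul_le_sq`, the
variational characterisation of `D_{n+1}/D_n` as the minimum of the Toeplitz form over vectors with
last coordinate `1`) applied to the regularised symbols `f_{t,0} + ε`, `ε > 0`, and continuity of
`D_n` in the symbol (`continuous_toeplitzDet_param`) as `ε → 0⁺` — Lenard's symbol vanishes at two
points, so the positive-symbol statement does not apply verbatim.  (2) rests on two lower bounds of
Szegő for a positive continuous `2π`-periodic symbol `w` with geometric mean
`G(w) = exp((2π)⁻¹∫ log w)`, proved here from the tree's Jensen inequality for Fejér means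
(`logSzego_fejerMean_le`, whose order-`0` Fejér mean is the constant `mean h`):
`G(w)ⁿ ≤ D_n(w)` (`logSzego_nonneg`, `geomMean_pow_le_toeplitzDet`) and the ratio bound
`G(w) D_n(w) ≤ D_{n+1}(w)` (`geomMean_mul_toeplitzDet_le_succ`: the ratios are non-increasing by (1)
and cannot drop below `G(w)` without violating `D_m ≥ G(w)^m` for large `m`)
(setting of [cite: DeiftItsKrasovsky2013, §1, eq. (1)–(3)]; the bounds are Szegő's classical
theory);
then `G(f_{t,0} + ε) ≥ G(f_{t,0}) = 1` because `(2π)⁻¹∫₀^{2π} log|e^{iθ} - a| dθ = 0` for `|a| = 1`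
(Mathlib's `circleAverage_log_norm_sub_const₁`, Jensen's formula) and the two symbols differ from
`log`-monotone comparison only on the countable zero set, and `ε → 0⁺` as in (1).

Relevance to the barrier (reading only, no new barrier claim): both facts are rigidity properties
of the explicit `d = 1` witness at fixed ring length; (1) is one half of the conjectured
monotonicity structure discussed in `scope_caveats` (t)(3)/(w)(3)/(x)(3) of the entry — the other
half, `t ↦ R(n, t)` monotone on `(0, π)`, remains untyped and unprinted — and (2) says that the
`√N` defect of condensation is never a decrease of coherence: `N ↦ c₀(N)` increases for every `L`.

## References

* [ForresterEtAl2003CMP] P. J. Forrester, N. E. Frankel, T. M. Garoni, N. S. Witte, *Painlevé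
  transcendent evaluations of finite system density matrices for 1d impenetrable bosons*,
  Comm. Math. Phys. 238 (2003) 257–285, arXiv:math-ph/0207005: §3.2 Prop. 4, eq. (3.51).
* [DeiftItsKrasovsky2013] P. Deift, A. Its, I. Krasovsky, *Toeplitz matrices and Toeplitz
  determinants under the impetus of the Ising model: some history and some recent results*,
  Comm. Pure Appl. Math. 66 (2013) 1360–1438: §1 (Toeplitz determinants, Szegő's theorems).
-/

noncomputable section

open MeasureTheory Filter Topology Complex
open Literature.Analysis.Toeplitz
open scoped Real

namespace Literature.Barriers.AtomisticToContinuum.BoseGas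

/-- The Toeplitz determinant of the regularised Lenard symbol `f_{t,0} + ε` is continuous in the
regularisation parameter `ε`. [folklore] -/
theorem continuous_toeplitzDet_lenardPoly_add_re (n : ℕ) (t : ℝ) :
    Continuous fun ε : ℝ =>
      (toeplitzDet (circleCoeff fun θ => ((‖lenardPoly t 0 θ‖ + ε : ℝ) : ℂ)) n).re := by
  refine Complex.continuous_re.comp ?_
  refine continuous_toeplitzDet_param
    (F := fun ε θ => ((‖lenardPoly t 0 θ‖ + ε : ℝ) : ℂ)) ?_ n
  exact Complex.continuous_ofReal.comp
    ((((continuous_lenardPoly t 0).comp continuous_snd).norm).add continuous_fst)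

/-- At `ε = 0` the regularised determinant is Lenard's determinant `R(n, t)`. [folklore] -/
theorem toeplitzDet_lenardPoly_add_zero_re (n : ℕ) (t : ℝ) :
    (toeplitzDet (circleCoeff fun θ => ((‖lenardPoly t 0 θ‖ + 0 : ℝ) : ℂ)) n).re = lenardDet n t := by
  simp only [add_zero]
  rfl

/-- **Log-concavity of Lenard's determinant in the size**: `R(n+2, t) R(n, t) ≤ R(n+1, t)²` for
every angle `t` — the Toeplitz log-concavity `D_{n+2} D_n ≤ D_{n+1}²` for Lenard's (non-negative,
vanishing) symbol, by regularisation `f + ε` and `ε → 0⁺`.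
[cite: ForresterEtAl2003CMP, §3.2 Prop. 4 (3.51)] -/
theorem lenardDet_succ_succ_mul_le_sq (n : ℕ) (t : ℝ) :
    lenardDet (n + 2) t * lenardDet n t ≤ lenardDet (n + 1) t ^ 2 := by
  set G : ℝ → ℕ → ℝ := fun ε k =>
    (toeplitzDet (circleCoeff fun θ => ((‖lenardPoly t 0 θ‖ + ε : ℝ) : ℂ)) k).re with hG
  have hreg : ∀ ε : ℝ, 0 < ε → G ε (n + 2) * G ε n ≤ G ε (n + 1) ^ 2 := fun ε hε =>
    toeplitzDet_succ_succ_mul_le_sq (w := fun θ => ‖lenardPoly t 0 θ‖ + ε)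
      ((continuous_lenardPoly t 0).norm.add continuous_const)
      (fun θ => add_pos_of_nonneg_of_pos (norm_nonneg _) hε) n
  have hcont : ∀ k, Continuous fun ε => G ε k := fun k =>
    continuous_toeplitzDet_lenardPoly_add_re k t
  have h0 : ∀ k, G 0 k = lenardDet k t := fun k => toeplitzDet_lenardPoly_add_zero_re k t
  have hlim₁ : Tendsto (fun ε => G ε (n + 2) * G ε n) (𝓝[>] 0)
      (𝓝 (lenardDet (n + 2) t * lenardDet n t)) := by
    rw [← h0, ← h0]
    exact (((hcont (n + 2)).mul (hcont n)).tendsto 0).mono_left nhdsWithin_le_nhds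
  have hlim₂ : Tendsto (fun ε => G ε (n + 1) ^ 2) (𝓝[>] 0) (𝓝 (lenardDet (n + 1) t ^ 2)) := by
    rw [← h0]
    exact (((hcont (n + 1)).pow 2).tendsto 0).mono_left nhdsWithin_le_nhds
  exact le_of_tendsto_of_tendsto hlim₁ hlim₂ (eventually_nhdsWithin_of_forall hreg)

/-- **Non-increasing growth ratios**: `R(n+2, t) R(n, t) ≤ R(n+1, t) R(n+1, t)` restated for the
ratios when the determinants are positive. [folklore] -/
theorem lenardDet_div_antitone {n : ℕ} {t : ℝ} (h₀ : 0 < lenardDet n t)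
    (h₁ : 0 < lenardDet (n + 1) t) :
    lenardDet (n + 2) t / lenardDet (n + 1) t ≤ lenardDet (n + 1) t / lenardDet n t := by
  rw [div_le_div_iff₀ h₁ h₀]
  have := lenardDet_succ_succ_mul_le_sq n t
  nlinarith [this]

variable {L : ℝ}

/-- **Log-concavity of Girardeau's density matrix in the particle number**:
`ρ_{N+2}(x, y) ρ_N(x, y) ≤ ρ_{N+1}(x, y)²` for all `N`, all `x, y` and every ring length `L > 0`
(`ρ_0 = 0`; for `N ≥ 1` this is Lenard's formula and `lenardDet_succ_succ_mul_le_sq`).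
[cite: ForresterEtAl2003CMP, §3.2 Prop. 4 (3.51)] -/
theorem girardeauDensityMatrix_succ_succ_mul_le_sq (hL : 0 < L) (N : ℕ) (x y : ℝ) :
    girardeauDensityMatrix (N + 2) L x y * girardeauDensityMatrix N L x y ≤
      girardeauDensityMatrix (N + 1) L x y ^ 2 := by
  cases N with
  | zero =>
    rw [show girardeauDensityMatrix 0 L x y = 0 from rfl, mul_zero]
    exact sq_nonneg _
  | succ m =>
    rw [show m + 1 + 2 = (m + 2) + 1 from rfl, girardeauDensityMatrix_eq_lenardDet hL,
      girardeauDensityMatrix_eq_lenardDet hL, girardeauDensityMatrix_eq_lenardDet hL]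
    have h := lenardDet_succ_succ_mul_le_sq m (2 * π * (x - y) / L)
    have hL2 : 0 ≤ L⁻¹ ^ 2 := sq_nonneg _
    calc L⁻¹ * lenardDet (m + 2) (2 * π * (x - y) / L) * (L⁻¹ * lenardDet m (2 * π * (x - y) / L))
        = L⁻¹ ^ 2 * (lenardDet (m + 2) (2 * π * (x - y) / L) *
            lenardDet m (2 * π * (x - y) / L)) := by ring
      _ ≤ L⁻¹ ^ 2 * lenardDet (m + 1) (2 * π * (x - y) / L) ^ 2 :=
          mul_le_mul_of_nonneg_left h hL2
      _ = (L⁻¹ * lenardDet (m + 1) (2 * π * (x - y) / L)) ^ 2 := by ring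

/-! ### Szegő's first lower bound `D_n(e^h) ≥ e^{n·mean h}` -/

/-- The Fejér kernel of order `0` is the constant `1`. [folklore] -/
theorem fejerKernel_zero (s : ℝ) : fejerKernel 0 s = 1 := by
  simp [fejerKernel, dirichletSum]

/-- The Fejér mean of order `0` is the constant `mean h`. [folklore] -/
theorem fejerMean_zero (h : ℝ → ℝ) : fejerMean 0 h = fun _ => symbolMean h := by
  funext θ
  simp [fejerMean, symbolMean, fejerKernel_zero]

/-- The Toeplitz matrix of a constant symbol `C` is `C · 1`. [folklore] -/
theorem toeplitzMatrix_const (C : ℂ) (n : ℕ) :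
    toeplitzMatrix (circleCoeff fun _ : ℝ => C) n = C • (1 : Matrix (Fin n) (Fin n) ℂ) := by
  ext j k
  simp only [toeplitzMatrix_apply, circleCoeff_const_fun, Matrix.smul_apply, Matrix.one_apply,
    smul_eq_mul, mul_ite, mul_one, mul_zero, sub_eq_zero, Nat.cast_inj, Fin.val_inj]

/-- The Toeplitz determinant of a constant symbol: `D_n(C) = Cⁿ`. [folklore] -/
theorem toeplitzDet_const (C : ℂ) (n : ℕ) : toeplitzDet (circleCoeff fun _ : ℝ => C) n = C ^ n := by
  rw [toeplitzDet, toeplitzMatrix_const, Matrix.det_smul, Matrix.det_one, mul_one, Fintype.card_fin]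

/-- The mean of a constant symbol. [folklore] -/
theorem symbolMean_const (c : ℝ) : symbolMean (fun _ : ℝ => c) = c := by
  unfold symbolMean
  rw [intervalIntegral.integral_const, smul_eq_mul]
  have hπ : Real.pi ≠ 0 := Real.pi_ne_zero
  field_simp
  ring

/-- `Φ_n` vanishes on constant symbols: `log D_n(e^c) - n c = 0`. [folklore] -/
theorem logSzego_const (n : ℕ) (c : ℝ) : logSzego n (fun _ : ℝ => c) = 0 := by
  unfold logSzego
  rw [toeplitzDet_const, symbolMean_const, ← Complex.ofReal_pow, Complex.ofReal_re, Real.log_pow,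
    Real.log_exp, sub_self]

/-- **Szegő's first lower bound** in logarithmic form: `Φ_n(h) = log D_n(e^h) - n·mean h ≥ 0` for a
continuous `2π`-periodic real symbol `h` (Jensen's inequality for the convex translation-invariant
functional `Φ_n`, averaged over all translations: `Φ_n(h) ≥ Φ_n(mean h) = 0`). [folklore] -/
theorem logSzego_nonneg (n : ℕ) {h : ℝ → ℝ} (hc : Continuous h)
    (hp : Function.Periodic h (2 * Real.pi)) : 0 ≤ logSzego n h := by
  have := logSzego_fejerMean_le n 0 hc hp
  rwa [fejerMean_zero, logSzego_const] at this

/-- **Szegő's first lower bound**: `e^{n · mean h} ≤ D_n(e^h)`. [folklore] -/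
theorem exp_mul_symbolMean_le_toeplitzDet (n : ℕ) {h : ℝ → ℝ} (hc : Continuous h)
    (hp : Function.Periodic h (2 * Real.pi)) :
    Real.exp (n * symbolMean h) ≤ (toeplitzDet (circleCoeff fun θ => (Real.exp (h θ) : ℂ)) n).re := by
  have h0 := logSzego_nonneg n hc hp
  unfold logSzego at h0
  rw [sub_nonneg, Real.le_log_iff_exp_le (toeplitzDet_exp_re_pos hc n)] at h0
  exact h0

/-- **Szegő's first lower bound for a positive symbol**: `G(w)ⁿ ≤ D_n(w)` with the geometric mean
`G(w) = exp((2π)⁻¹∫ log w)`. [folklore] -/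
theorem geomMean_pow_le_toeplitzDet {w : ℝ → ℝ} (hw : Continuous w) (hpos : ∀ θ, 0 < w θ)
    (hp : Function.Periodic w (2 * Real.pi)) (n : ℕ) :
    Real.exp (symbolMean fun θ => Real.log (w θ)) ^ n ≤
      (toeplitzDet (circleCoeff fun θ => (w θ : ℂ)) n).re := by
  have hc : Continuous fun θ => Real.log (w θ) :=
    hw.log fun θ => (hpos θ).ne'
  have hper : Function.Periodic (fun θ => Real.log (w θ)) (2 * Real.pi) := fun θ => by
    simp only [hp θ]
  have h := exp_mul_symbolMean_le_toeplitzDet n hc hper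
  have hfun : (fun θ => (Real.exp (Real.log (w θ)) : ℂ)) = fun θ => (w θ : ℂ) := by
    funext θ; rw [Real.exp_log (hpos θ)]
  rwa [hfun, Real.exp_nat_mul] at h


/-! ### Szegő's ratio bound `G(w) · D_n(w) ≤ D_{n+1}(w)` -/

/-- **Szegő's ratio bound**: `G(w) D_n(w) ≤ D_{n+1}(w)` for a positive continuous `2π`-periodic
symbol — the non-increasing ratios `D_{n+1}/D_n` (log-concavity, `toeplitzDet_succ_succ_mul_le_sq`)
never drop below the geometric mean, since `D_m ≥ G^m` for all `m`
(`geomMean_pow_le_toeplitzDet`). [folklore] -/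
theorem geomMean_mul_toeplitzDet_le_succ {w : ℝ → ℝ} (hw : Continuous w) (hpos : ∀ θ, 0 < w θ)
    (hp : Function.Periodic w (2 * Real.pi)) (n : ℕ) :
    Real.exp (symbolMean fun θ => Real.log (w θ)) *
        (toeplitzDet (circleCoeff fun θ => (w θ : ℂ)) n).re ≤
      (toeplitzDet (circleCoeff fun θ => (w θ : ℂ)) (n + 1)).re := by
  set D : ℕ → ℝ := fun k => (toeplitzDet (circleCoeff fun θ => (w θ : ℂ)) k).re with hD
  set G : ℝ := Real.exp (symbolMean fun θ => Real.log (w θ)) with hG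
  have hGpos : 0 < G := Real.exp_pos _
  have hDpos : ∀ k, 0 < D k := fun k => (toeplitzDet_pos hw hpos k).1
  have hlow : ∀ k, G ^ k ≤ D k := fun k => geomMean_pow_le_toeplitzDet hw hpos hp k
  set q : ℕ → ℝ := fun k => D (k + 1) / D k with hq
  have hqpos : ∀ k, 0 < q k := fun k => div_pos (hDpos _) (hDpos _)
  have hq_anti : Antitone q := by
    refine antitone_nat_of_succ_le fun k => ?_
    change D (k + 1 + 1) / D (k + 1) ≤ D (k + 1) / D k
    rw [div_le_div_iff₀ (hDpos _) (hDpos _)]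
    have h := toeplitzDet_succ_succ_mul_le_sq hw hpos k
    change D (k + 2) * D k ≤ D (k + 1) ^ 2 at h
    rw [sq] at h
    exact h
  have hgrow : ∀ m, D (n + m) ≤ D n * q n ^ m := by
    intro m
    induction m with
    | zero => simp
    | succ m ih =>
      have hstep : D (n + m + 1) = q (n + m) * D (n + m) := by
        change D (n + m + 1) = D (n + m + 1) / D (n + m) * D (n + m)
        rw [div_mul_cancel₀ _ (hDpos _).ne']
      have hqm : q (n + m) ≤ q n := hq_anti (Nat.le_add_right n m)
      calc D (n + (m + 1)) = q (n + m) * D (n + m) := by rw [← add_assoc]; exact hstep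
        _ ≤ q n * (D n * q n ^ m) := mul_le_mul hqm ih (hDpos _).le (hqpos _).le
        _ = D n * q n ^ (m + 1) := by ring
  change G * D n ≤ D (n + 1)
  suffices hGq : G ≤ q n by
    have := (le_div_iff₀ (hDpos n)).1 hGq
    exact this
  by_contra hle
  have hlt : q n < G := not_le.mp hle
  have hr : 1 < G / q n := (one_lt_div (hqpos n)).2 hlt
  have hbound : ∀ m, (G / q n) ^ m ≤ D n / G ^ n := by
    intro m
    have h1 : G ^ (n + m) ≤ D n * q n ^ m := (hlow (n + m)).trans (hgrow m)
    rw [pow_add] at h1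
    rw [div_pow, div_le_div_iff₀ (pow_pos (hqpos n) m) (pow_pos hGpos n)]
    linarith [h1]
  obtain ⟨m, hm⟩ :=
    ((tendsto_pow_atTop_atTop_of_one_lt hr).eventually (eventually_gt_atTop (D n / G ^ n))).exists
  exact lt_irrefl _ ((hbound m).trans_lt hm)

/-! ### The geometric mean of Lenard's symbol is `1` -/

/-- `∫₀^{2π} log |e^{iθ} - a| dθ = 0` for `|a| = 1` (Jensen). [folklore] -/
theorem integral_log_norm_cexp_sub (a : ℂ) (ha : ‖a‖ = 1) :
    ∫ θ in (0 : ℝ)..2 * π, Real.log ‖cexp (θ * I) - a‖ = 0 := by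
  have h := circleAverage_log_norm_sub_const₁ ha
  rw [Real.circleAverage_def] at h
  simp only [circleMap_zero, Complex.ofReal_one, one_mul] at h
  rw [smul_eq_zero] at h
  exact h.resolve_left (inv_ne_zero (by positivity))

/-- `θ ↦ log |e^{iθ} - a|` is integrable on `[0, 2π]`. [folklore] -/
theorem intervalIntegrable_log_norm_cexp_sub (a : ℂ) :
    IntervalIntegrable (fun θ : ℝ => Real.log ‖cexp (θ * I) - a‖) volume 0 (2 * π) := by
  have h := circleIntegrable_log_norm_sub_const (a := a) (c := 0) 1
  simp only [CircleIntegrable, circleMap_zero, Complex.ofReal_one, one_mul] at h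
  exact h

/-- The exceptional set `{θ : e^{iθ} = e^{ia}}` is countable. [folklore] -/
theorem countable_setOf_cexp_eq (a : ℝ) : {θ : ℝ | cexp (θ * I) = cexp (a * I)}.Countable := by
  have hsub : {θ : ℝ | cexp (θ * I) = cexp (a * I)} ⊆
      Set.range fun n : ℤ => a + n * (2 * π) := by
    intro θ hθ
    obtain ⟨n, hn⟩ := Complex.exp_eq_exp_iff_exists_int.1 hθ
    refine ⟨n, ?_⟩
    have him := congrArg Complex.im hn
    simp only [Complex.mul_im, Complex.ofReal_re, Complex.I_im, mul_one, Complex.ofReal_im,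
      Complex.I_re, mul_zero, add_zero, Complex.add_im, Complex.mul_re,
      Complex.intCast_re, Complex.intCast_im, Complex.re_ofNat, Complex.im_ofNat,
      zero_mul, sub_zero, mul_im, mul_re] at him
    linarith [him]
  exact (Set.countable_range _).mono hsub

/-- **Szegő's mean of Lenard's regularised symbol is non-negative**:
`∫₀^{2π} log (f_{t,0}(θ) + ε) dθ ≥ 0 = ∫₀^{2π} log f_{t,0}(θ) dθ` for `ε > 0`. [folklore] -/
theorem integral_log_lenard_add_nonneg (t : ℝ) {ε : ℝ} (hε : 0 < ε) :
    0 ≤ ∫ θ in (0 : ℝ)..2 * π, Real.log (‖lenardPoly t 0 θ‖ + ε) := by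
  have h1 := integral_log_norm_cexp_sub (cexp (t * I)) (by exact_mod_cast norm_exp_ofReal_mul_I t)
  have h2 := integral_log_norm_cexp_sub 1 (by simp)
  have hi1 := intervalIntegrable_log_norm_cexp_sub (cexp (t * I))
  have hi2 := intervalIntegrable_log_norm_cexp_sub (1 : ℂ)
  have hsum : ∫ θ in (0 : ℝ)..2 * π,
      (Real.log ‖cexp (θ * I) - cexp (t * I)‖ + Real.log ‖cexp (θ * I) - 1‖) = 0 := by
    rw [intervalIntegral.integral_add hi1 hi2, h1, h2, add_zero]
  refine le_of_eq_of_le hsum.symm ?_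
  have hcont : Continuous fun θ : ℝ => Real.log (‖lenardPoly t 0 θ‖ + ε) :=
    ((continuous_lenardPoly t 0).norm.add continuous_const).log
      fun θ => (add_pos_of_nonneg_of_pos (norm_nonneg _) hε).ne'
  refine intervalIntegral.integral_mono_ae (by positivity) (hi1.add hi2)
    (hcont.intervalIntegrable _ _) ?_
  have hZ : ({θ : ℝ | cexp (θ * I) = cexp (t * I)} ∪ {θ : ℝ | cexp (θ * I) = cexp (0 * I)}).Countable :=
    (countable_setOf_cexp_eq t).union (countable_setOf_cexp_eq 0)
  filter_upwards [hZ.ae_notMem volume] with θ hθ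
  simp only [Set.mem_union, Set.mem_setOf_eq, not_or] at hθ
  have hne1 : cexp (θ * I) - cexp (t * I) ≠ 0 := sub_ne_zero.2 hθ.1
  have hne2 : cexp (θ * I) - 1 ≠ 0 := by
    have := hθ.2
    rw [zero_mul, Complex.exp_zero] at this
    exact sub_ne_zero.2 this
  have hprod : ‖lenardPoly t 0 θ‖ = ‖cexp (θ * I) - cexp (t * I)‖ * ‖cexp (θ * I) - 1‖ := by
    rw [lenardPoly, norm_mul, Complex.ofReal_zero, zero_mul, Complex.exp_zero]
  rw [← Real.log_mul (norm_ne_zero_iff.2 hne1) (norm_ne_zero_iff.2 hne2), ← hprod]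
  exact Real.log_le_log (by rw [hprod]; exact mul_pos (norm_pos_iff.2 hne1) (norm_pos_iff.2 hne2))
    (le_add_of_nonneg_right hε.le)

/-- Lenard's regularised symbol is `2π`-periodic. [folklore] -/
theorem lenardPoly_add_two_pi (t θ : ℝ) : lenardPoly t 0 (θ + 2 * π) = lenardPoly t 0 θ := by
  unfold lenardPoly
  rw [cexp_add_two_pi_mul_I]

/-- **The geometric mean of `f_{t,0} + ε` is at least `1`**: `mean log (f_{t,0} + ε) ≥ 0`.
[folklore] -/
theorem symbolMean_log_lenard_add_nonneg (t : ℝ) {ε : ℝ} (hε : 0 < ε) :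
    0 ≤ symbolMean fun θ => Real.log (‖lenardPoly t 0 θ‖ + ε) := by
  have hper : Function.Periodic (fun θ => Real.log (‖lenardPoly t 0 θ‖ + ε)) (2 * π) := fun θ => by
    simp only [lenardPoly_add_two_pi]
  unfold symbolMean
  have h := hper.intervalIntegral_add_eq (-π) 0
  rw [show -π + 2 * π = π by ring, zero_add] at h
  rw [h]
  exact mul_nonneg (inv_nonneg.2 (by positivity)) (integral_log_lenard_add_nonneg t hε)

/-! ### Monotonicity of Lenard's determinant in the size -/

/-- The regularised determinants increase with the size: `D_n(f_{t,0} + ε) ≤ D_{n+1}(f_{t,0} + ε)`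
for `ε > 0`. [folklore] -/
theorem toeplitzDet_lenard_add_re_le_succ (n : ℕ) (t : ℝ) {ε : ℝ} (hε : 0 < ε) :
    (toeplitzDet (circleCoeff fun θ => ((‖lenardPoly t 0 θ‖ + ε : ℝ) : ℂ)) n).re ≤
      (toeplitzDet (circleCoeff fun θ => ((‖lenardPoly t 0 θ‖ + ε : ℝ) : ℂ)) (n + 1)).re := by
  have hw : Continuous fun θ => ‖lenardPoly t 0 θ‖ + ε :=
    (continuous_lenardPoly t 0).norm.add continuous_const
  have hpos : ∀ θ, 0 < ‖lenardPoly t 0 θ‖ + ε := fun θ =>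
    add_pos_of_nonneg_of_pos (norm_nonneg _) hε
  have hp : Function.Periodic (fun θ => ‖lenardPoly t 0 θ‖ + ε) (2 * π) := fun θ => by
    simp only [lenardPoly_add_two_pi]
  have h := geomMean_mul_toeplitzDet_le_succ hw hpos hp n
  have hG : 1 ≤ Real.exp (symbolMean fun θ => Real.log (‖lenardPoly t 0 θ‖ + ε)) :=
    Real.one_le_exp (symbolMean_log_lenard_add_nonneg t hε)
  have hD : 0 ≤ (toeplitzDet (circleCoeff fun θ => ((‖lenardPoly t 0 θ‖ + ε : ℝ) : ℂ)) n).re :=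
    (toeplitzDet_pos hw hpos n).1.le
  calc (toeplitzDet (circleCoeff fun θ => ((‖lenardPoly t 0 θ‖ + ε : ℝ) : ℂ)) n).re
      = 1 * (toeplitzDet (circleCoeff fun θ => ((‖lenardPoly t 0 θ‖ + ε : ℝ) : ℂ)) n).re := (one_mul _).symm
    _ ≤ Real.exp (symbolMean fun θ => Real.log (‖lenardPoly t 0 θ‖ + ε)) *
          (toeplitzDet (circleCoeff fun θ => ((‖lenardPoly t 0 θ‖ + ε : ℝ) : ℂ)) n).re :=
        mul_le_mul_of_nonneg_right hG hD
    _ ≤ _ := h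

/-- **Monotonicity of Lenard's determinant in the size**: `R(n, t) ≤ R(n+1, t)` for every angle `t`
and every `n` (Szegő: the non-increasing ratios `R(n+1,t)/R(n,t)` dominate the geometric mean
`G(f_{t,0}) = 1` of Lenard's symbol; proved through the regularisation `f_{t,0} + ε`, `ε → 0⁺`).
[folklore] -/
theorem lenardDet_le_succ (n : ℕ) (t : ℝ) : lenardDet n t ≤ lenardDet (n + 1) t := by
  set G : ℝ → ℕ → ℝ := fun ε k =>
    (toeplitzDet (circleCoeff fun θ => ((‖lenardPoly t 0 θ‖ + ε : ℝ) : ℂ)) k).re with hG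
  have hcont : ∀ k, Continuous fun ε => G ε k := fun k =>
    continuous_toeplitzDet_lenardPoly_add_re k t
  have h0 : ∀ k, G 0 k = lenardDet k t := fun k => toeplitzDet_lenardPoly_add_zero_re k t
  have hlim₁ : Tendsto (fun ε => G ε n) (𝓝[>] 0) (𝓝 (lenardDet n t)) := by
    rw [← h0]
    exact ((hcont n).tendsto 0).mono_left nhdsWithin_le_nhds
  have hlim₂ : Tendsto (fun ε => G ε (n + 1)) (𝓝[>] 0) (𝓝 (lenardDet (n + 1) t)) := by
    rw [← h0]
    exact ((hcont (n + 1)).tendsto 0).mono_left nhdsWithin_le_nhds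
  exact le_of_tendsto_of_tendsto hlim₁ hlim₂
    (eventually_nhdsWithin_of_forall fun ε hε => toeplitzDet_lenard_add_re_le_succ n t hε)

/-- `n ↦ R(n, t)` is monotone. [folklore] -/
theorem lenardDet_monotone (t : ℝ) : Monotone fun n => lenardDet n t :=
  monotone_nat_of_le_succ fun n => lenardDet_le_succ n t

/-- `R(n, t) ≥ R(0, t) = 1`. [folklore] -/
theorem one_le_lenardDet (n : ℕ) (t : ℝ) : 1 ≤ lenardDet n t := by
  have h := lenardDet_monotone t (Nat.zero_le n)
  simpa using h

/-! ### Consequences for Girardeau's gas: monotonicity in `N` -/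

/-- **Adding a particle never decreases the one-body density matrix anywhere**:
`ρ_N(x, y) ≤ ρ_{N+1}(x, y)` for Girardeau's ground states on a ring of length `L > 0`.
[folklore] -/
theorem girardeauDensityMatrix_le_succ (hL : 0 < L) (N : ℕ) (x y : ℝ) :
    girardeauDensityMatrix N L x y ≤ girardeauDensityMatrix (N + 1) L x y := by
  cases N with
  | zero => exact girardeauDensityMatrix_nonneg _ _ _ _
  | succ m =>
    rw [girardeauDensityMatrix_eq_lenardDet hL, girardeauDensityMatrix_eq_lenardDet hL]
    exact mul_le_mul_of_nonneg_left (lenardDet_le_succ m _) (inv_nonneg.2 hL.le)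

/-- `N ↦ ρ_N(x, y)` is monotone. [folklore] -/
theorem girardeauDensityMatrix_monotone (hL : 0 < L) (x y : ℝ) :
    Monotone fun N => girardeauDensityMatrix N L x y :=
  monotone_nat_of_le_succ fun N => girardeauDensityMatrix_le_succ hL N x y

/-- **Uniform off-diagonal floor**: `ρ_N(x, y) ≥ 1/L` for all `N ≥ 1` and all `x, y` — the density
matrix of the impenetrable ring gas never drops below its one-particle value. [folklore] -/
theorem inv_le_girardeauDensityMatrix (hL : 0 < L) (N : ℕ) (x y : ℝ) :
    L⁻¹ ≤ girardeauDensityMatrix (N + 1) L x y := by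
  rw [girardeauDensityMatrix_eq_lenardDet hL]
  have h := one_le_lenardDet N (2 * π * (x - y) / L)
  have hL' : 0 ≤ L⁻¹ := inv_nonneg.2 hL.le
  nlinarith [h, hL']

/-- **The condensate occupation is monotone in the particle number**:
`c₀(N) ≤ c₀(N+1)` at fixed ring length. [folklore] -/
theorem zeroMomentumOccupation_le_succ (hL : 0 < L) (N : ℕ) :
    zeroMomentumOccupation N L ≤ zeroMomentumOccupation (N + 1) L := by
  cases N with
  | zero => rw [zeroMomentumOccupation_zero]; exact zeroMomentumOccupation_nonneg _ hL
  | succ m =>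
    rw [zeroMomentumOccupation_succ_eq_integral hL, zeroMomentumOccupation_succ_eq_integral hL]
    refine mul_le_mul_of_nonneg_left ?_ (inv_nonneg.2 (by positivity))
    exact intervalIntegral.integral_mono_on (by positivity)
      ((continuous_lenardDet m).intervalIntegrable _ _)
      ((continuous_lenardDet (m + 1)).intervalIntegrable _ _)
      fun t _ => lenardDet_le_succ m t

/-- `N ↦ c₀(N)` is monotone. [folklore] -/
theorem zeroMomentumOccupation_monotone (hL : 0 < L) :
    Monotone fun N => zeroMomentumOccupation N L :=
  monotone_nat_of_le_succ fun N => zeroMomentumOccupation_le_succ hL N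

end Literature.Barriers.AtomisticToContinuum.BoseGas

end
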